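import Summits.Langlands.Langlands.Theses.ParityBlindBianchi
import Literature.NumberTheory.Automorphic.BaseChangeUnramifiedLift
import Literature.NumberTheory.Automorphic.BaseChangeArchimedean
import Literature.NumberTheory.Automorphic.SerreConjecture
import Literature.NumberTheory.GaloisRepresentations.ArtinRestriction
import HarnessLib

/-!
# Sketch — crux-ideate stmt-Langlands-15112 (`ParityBlindBianchi.ResidualBianchiDoorLevel`, E1′)
# idea `inertia-blind-satake-law`: first-lemma signatures (must elaborate; proofs not owed here)
-/

noncomputable section

open scoped MatrixGroups NumberField Polynomial Classical
open NumberField IsDedekindDomain Field Filter Polynomial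
open Literature.NumberTheory.GaloisRepresentations Literature.NumberTheory.Automorphic

namespace Summit.Langlands.Langlands.Cruxes.ResidualBianchiDoorLevel.InertiaBlindSatakeLaw

set_option linter.dupNamespace false

/-- **All-finite-places Satake law of a base-change lift** (the predicate the new named fact should
inhabit): Arthur–Clozel's relation (1.1) `t_{P,w} = t_{π,v}^{f(w|v)}` at EVERY finite place `w`
of `E` over a place `v` of `F` at which `π` has a Satake parameter — no hypothesis that `v` be
unramified in `E` (at a ramified `v` of prime degree, `f(w|v) = 1` and the local lift of the
unramified `π_v = π(μ₁,…,μ_n)` is the unramified `π(μ₁∘N,…,μ_n∘N)`: AC Ch. 1 §6.2, induced case of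
Thm. 6.2, with Def. 6.1 for `GL(1)`; Ch. 3 Thm. 5.1; for `GL(2)` Langlands 1980 / Gelbart 1997
§6.1, p. 249).  It is `IsUnramifiedBaseChangeLift` with `Algebra.IsUnramifiedIn` deleted. -/
def IsAllFiniteBaseChangeLift {n : ℕ} {F E : Type} [Field F] [NumberField F] [Field E]
    [NumberField E] [Algebra F E] {hF : isCompact_glFiniteIntegralLevel n F}
    {hE : isCompact_glFiniteIntegralLevel n E}
    (π : AutomorphicRepData (AutomorphyDatum.gl n F hF))
    (P : AutomorphicRepData (AutomorphyDatum.gl n E hE)) : Prop :=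
  ∀ (w : HeightOneSpectrum (𝓞 E)) (v : HeightOneSpectrum (𝓞 F)) (α : Multiset ℂ),
    w.asIdeal.under (𝓞 F) = v.asIdeal → π.HasSatakeParamAt v α →
      P.HasSatakeParamAt w (α.map (· ^ w.asIdeal.inertiaDeg (𝓞 F)))

/-- An all-finite-places lift is in particular an unramified strong lift (tree predicate), hence a
weak lift, regular algebraic when `π` is, etc. (pure logic). -/
theorem IsAllFiniteBaseChangeLift.isUnramifiedBaseChangeLift {n : ℕ} {F E : Type} [Field F]
    [NumberField F] [Field E] [NumberField E] [Algebra F E]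
    {hF : isCompact_glFiniteIntegralLevel n F} {hE : isCompact_glFiniteIntegralLevel n E}
    {π : AutomorphicRepData (AutomorphyDatum.gl n F hF)}
    {P : AutomorphicRepData (AutomorphyDatum.gl n E hE)} (h : IsAllFiniteBaseChangeLift π P) :
    IsUnramifiedBaseChangeLift π P :=
  fun w v α hw _ hα => h w v α hw hα

/-- **Proposed named fact (shape), quadratic cuspidal base change at every finite place, with an
inert-asymmetry cuspidality witness.**  `E/F` quadratic (Galois of degree `2`), `π` cuspidal on
`GL_n(𝔸_F)`; if at some place `v` of `F` that is UNRAMIFIED and INERT in `E` (a unique place of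
`E` above it) `π` has a Satake parameter `α` with `α ≠ -α` as multisets (so `π_v ≇ π_v ⊗ η_v` for
the quadratic character `η = η_{E/F}`, unramified of order `2` at `v`, whence `π ≇ π ⊗ η`), then
`π` has a CUSPIDAL lift `P` to `GL_n(𝔸_E)` with the Satake law at every finite place
(`IsAllFiniteBaseChangeLift`).  Printed: Arthur–Clozel Ch. 3 Thm. 4.2 (a) + Thm. 5.1 + Ch. 1 §6.2;
Gelbart 1997 Thm. 6.1 (a) [Langlands 1980] for `n = 2`.  (Faithful alternative for the factforge:
conclusion as a dichotomy "cuspidal all-places lift ∨ `π_v ≅ π_v ⊗ η_v` at almost every inert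
unramified `v`".) -/
def QuadraticCuspidalBaseChangeAllFinite : Prop :=
  ∀ (n : ℕ) (F E : Type) [Field F] [NumberField F] [Field E] [NumberField E] [Algebra F E]
    [IsGalois F E], Module.finrank F E = 2 →
    ∀ (hF : isCompact_glFiniteIntegralLevel n F) (π : CuspidalAutomorphicRepData n F hF),
      (∃ (v : HeightOneSpectrum (𝓞 F)) (α : Multiset ℂ),
          Algebra.IsUnramifiedIn (𝓞 E) v.asIdeal ∧
          (∀ w w' : HeightOneSpectrum (𝓞 E), w.asIdeal.under (𝓞 F) = v.asIdeal →
              w'.asIdeal.under (𝓞 F) = v.asIdeal → w = w') ∧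
          π.1.HasSatakeParamAt v α ∧ α.map (fun a => -a) ≠ α) →
      ∀ (hE : isCompact_glFiniteIntegralLevel n E),
        ∃ P : CuspidalAutomorphicRepData n E hE, IsAllFiniteBaseChangeLift π.1 P.1

/-- **FIRST LEMMA (fact-free, provable now): residual congruences ride the Satake power law.**
Let `σ₀ : Γ_ℚ → GL₂(ℚ̄₂)` have finite image, `π` a cuspidal datum on `GL₂(𝔸_ℚ)` whose C-normalised
Frobenius polynomial `arithFrobPolyOfSatake ι q 2 α_q` is congruent coefficientwise (mod the
maximal ideal of `ℤ̄₂`) to `charpoly σ₀(Frob_q)` at every place `q` over no prime of `S₀`, and `P`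
a datum on `GL₂(𝔸_K)` satisfying the all-finite-places law with respect to `π`.  Then at EVERY
place `w` of `K` over no prime of `S₀` — split, inert or RAMIFIED in `K/ℚ` — `P` has the Satake
parameter `α_q^{f(w|q)}`, `σ₀|_K` is unramified with `charpoly σ₀|_K(Frob_w) = ψ^{f}(charpoly
σ₀(Frob_q))` (tree: `FramedGaloisRep.hasFrobCharpolyAt_restrictField_fin_two`), and the two
`f`-th-power polynomials are again congruent (`q_w = q^f`, `√(q^f) = (√q)^f`, and `ψ^f` commutes
with reduction for monic quadratics with integral roots).  This is the per-`K` half of E1′ below the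
named facts. -/
theorem residual_transfer (ι : PadicAlgCl 2 ≃+* ℂ) (K : Type) [Field K] [NumberField K]
    (σ₀ : FramedGaloisRep ℚ (PadicAlgCl 2) 2) (hfin : Finite σ₀.toMonoidHom.range)
    (S₀ : Finset ℕ) (hQ : isCompact_glFiniteIntegralLevel 2 ℚ)
    (π : CuspidalAutomorphicRepData 2 ℚ hQ) (hK : isCompact_glFiniteIntegralLevel 2 K)
    (P : CuspidalAutomorphicRepData 2 K hK) (hlaw : IsAllFiniteBaseChangeLift π.1 P.1)
    (hcong : ∀ v : HeightOneSpectrum (𝓞 ℚ), (∀ ℓ ∈ S₀, ((ℓ : ℕ) : 𝓞 ℚ) ∉ v.asIdeal) →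
      ∃ (α : Multiset ℂ) (Pv : Polynomial (PadicAlgCl 2)), π.1.HasSatakeParamAt v α ∧
        σ₀.IsUnramifiedAt v ∧ σ₀.HasFrobCharpolyAt v Pv ∧
        ∀ i : ℕ, ‖Pv.coeff i - (arithFrobPolyOfSatake ι v.residueCard 2 α).coeff i‖ < 1) :
    ∀ w : HeightOneSpectrum (𝓞 K), (∀ ℓ ∈ S₀, ((ℓ : ℕ) : 𝓞 K) ∉ w.asIdeal) →
      ∃ (α : Multiset ℂ) (Pw : Polynomial (PadicAlgCl 2)), P.1.HasSatakeParamAt w α ∧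
        (σ₀.restrictField K).IsUnramifiedAt w ∧ (σ₀.restrictField K).HasFrobCharpolyAt w Pw ∧
        ∀ i : ℕ, ‖Pw.coeff i - (arithFrobPolyOfSatake ι w.residueCard 2 α).coeff i‖ < 1 := by
  sorry

/-- **The inert-asymmetry witness exists for every admissible `K` (Chebotarev, PROVED in the tree as
`chebotarev_artinRep_holds`).**  Shape of the statement the line needs: for `σ₀` with finite image
and projective image `A₅` and a cuspidal `π` congruent to it off `S₀` as above, and any quadratic
`K`, there is a place `v ∉ S₀`, unramified and inert in `K`, where `π` has a Satake pair `{x, y}`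
with `x + y ≠ 0` (because `tr σ̄₀(Frob_v) ≠ 0` for `Frob_v` of projective order `3` or `5`, and
`Gal(L_{σ̄₀}K/ℚ) = G × C₂` as the mod-`2` image `G` has no subgroup of index `2`). -/
theorem exists_inert_witness (ι : PadicAlgCl 2 ≃+* ℂ) (K : Type) [Field K] [NumberField K]
    (hK2 : Module.finrank ℚ K = 2)
    (σ₀ : FramedGaloisRep ℚ (PadicAlgCl 2) 2) (hfin : Finite σ₀.toMonoidHom.range)
    (hA5 : Nonempty ((Matrix.ProjGenLinGroup.mk.comp σ₀.toMonoidHom).range ≃*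
      alternatingGroup (Fin 5)))
    (S₀ : Finset ℕ) (hQ : isCompact_glFiniteIntegralLevel 2 ℚ)
    (π : CuspidalAutomorphicRepData 2 ℚ hQ)
    (hcong : ∀ v : HeightOneSpectrum (𝓞 ℚ), (∀ ℓ ∈ S₀, ((ℓ : ℕ) : 𝓞 ℚ) ∉ v.asIdeal) →
      ∃ (α : Multiset ℂ) (Pv : Polynomial (PadicAlgCl 2)), π.1.HasSatakeParamAt v α ∧
        σ₀.IsUnramifiedAt v ∧ σ₀.HasFrobCharpolyAt v Pv ∧
        ∀ i : ℕ, ‖Pv.coeff i - (arithFrobPolyOfSatake ι v.residueCard 2 α).coeff i‖ < 1) :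
    ∃ (v : HeightOneSpectrum (𝓞 ℚ)) (x y : ℂ), (∀ ℓ ∈ S₀, ((ℓ : ℕ) : 𝓞 ℚ) ∉ v.asIdeal) ∧
      Algebra.IsUnramifiedIn (𝓞 K) v.asIdeal ∧
      (∀ w w' : HeightOneSpectrum (𝓞 K), w.asIdeal.under (𝓞 ℚ) = v.asIdeal →
          w'.asIdeal.under (𝓞 ℚ) = v.asIdeal → w = w') ∧
      π.1.HasSatakeParamAt v ({x, y} : Multiset ℂ) ∧ x + y ≠ 0 := by
  sorry

/-- **Shape of the ℚ-side input** (the sibling crux's landed dictionary, re-run at `p = 2` with the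
dual seed / `ε⁻¹`-twist, EVERY place off `S₀`, unitary C-normalisation `m = 2`, and regular
algebraicity from the even Serre weight `w ∈ {2, 4}`): granted `khare_wintenberger 2 k`, an
irreducible `ρ` with projective image `A₅` yields `S₀ ∋ 2` and a regular algebraic cuspidal `π` on
`GL₂(𝔸_ℚ)` congruent to `σ₀ = GL₂(ι⁻¹) ∘ ρ` at every place off `S₀`. -/
theorem rational_seed
    (hKW : ∀ (k : Type) [Field k] [TopologicalSpace k] [DiscreteTopology k],
      khare_wintenberger 2 k)
    (ι : PadicAlgCl 2 ≃+* ℂ) (ρ : FramedGaloisRep ℚ ℂ 2) (hirr : ρ.toGaloisRep.IsIrreducible)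
    (hA5 : Nonempty ((Matrix.ProjGenLinGroup.mk.comp ρ.toMonoidHom).range ≃*
      alternatingGroup (Fin 5)))
    (hQ : isCompact_glFiniteIntegralLevel 2 ℚ) :
    ∃ (S₀ : Finset ℕ) (σ₀ : FramedGaloisRep ℚ (PadicAlgCl 2) 2)
      (π : CuspidalAutomorphicRepData 2 ℚ hQ), 2 ∈ S₀ ∧
      σ₀.toMonoidHom = (Matrix.GeneralLinearGroup.map ι.symm.toRingHom).comp ρ.toMonoidHom ∧
      Finite σ₀.toMonoidHom.range ∧ π.1.IsRegularAlgebraic ∧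
      ∀ v : HeightOneSpectrum (𝓞 ℚ), (∀ ℓ ∈ S₀, ((ℓ : ℕ) : 𝓞 ℚ) ∉ v.asIdeal) →
        ∃ (α : Multiset ℂ) (Pv : Polynomial (PadicAlgCl 2)), π.1.HasSatakeParamAt v α ∧
          σ₀.IsUnramifiedAt v ∧ σ₀.HasFrobCharpolyAt v Pv ∧
          ∀ i : ℕ, ‖Pv.coeff i - (arithFrobPolyOfSatake ι v.residueCard 2 α).coeff i‖ < 1 := by
  sorry

/-- **Composition target of the line** (trust base = {`khare_wintenberger 2 ·`, the NEW
`QuadraticCuspidalBaseChangeAllFinite`, `ArthurClozel1989_strongLifting_archimedean` for the ascent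
of regular algebraicity}; Chebotarev and `isCompact_glFiniteIntegralLevel_holds` are theorems). -/
theorem ResidualBianchiDoorLevel_of
    (hKW : ∀ (k : Type) [Field k] [TopologicalSpace k] [DiscreteTopology k],
      khare_wintenberger 2 k)
    (hBC : QuadraticCuspidalBaseChangeAllFinite)
    (harch : ArthurClozel1989_strongLifting_archimedean) :
    Summit.Langlands.Langlands.Theses.ParityBlindBianchi.ResidualBianchiDoorLevel := by
  sorry

end Summit.Langlands.Langlands.Cruxes.ResidualBianchiDoorLevel.InertiaBlindSatakeLaw

end
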